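import Summits.ValiantsHypothesis.ValiantsHypothesis.Theorems.RigidityForcesSymmetryRankRigidMinimalReprLaplaceResidualCaseOneKernel

/-!
# The `a = 3` residual of `LaplaceOptimal 5`: SLOT TRANSPORT (the two non-hub labellings reduce to `(0; 01,02,34)`) and the
# Case-1 / Case-2 dichotomy per configuration (crux `RankRigidMinimalRepr`, stmt-18034; frontier rung `LaplaceOptimalFive`, stmt-24813)

Lead file of the three-hand cut on the four residual configurations of `laplace_five_three_slices_residual`
(val-lit desk g12 RULING #263 (c): val-port-2 = reduction + assembly skeleton, val-lit-p8 g11 = Case 1, val-lit-p3 g14 =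
Case 2).  All statements are in the normal-form format of the residual hypothesis `hres` of
`LaplaceFiveSlices.laplace_five_at_most_two_slices_of_residual`: slices `α k (v k) · W k v` on the slots `0,1,2`
(cofactor `W k` blind to slot `k`), three pair terms `u t v · w t v` on cuts `(p t, q t)` (`u t` reads the two cut slots,
`w t` is blind to them), and the identity `[v injective] = Σ slices + Σ pairs`.  No definitions; every «configuration
statement» is spelled out as a `∀`-proposition.

* `indicator_of_not_fullSupport` — the Case-1/Case-2 DICHOTOMY on a slice vector: if NO covector with all coordinates
  non-zero is orthogonal to `α`, then `α` is a non-zero multiple of a basis vector (contrapositive of STEP 0,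
  `exists_fullSupport_orthogonal'`).
* `config_of_cases` — for any cut pattern `(p, q)`: Case 1 («some full-support covector ⊥ α 0», the hypothesis `hfull` of
  val-lit-p8's `triangle_case1` / `outside_case1`) and Case 2 («`α 0` is a letter indicator», val-lit-p3's files) together
  refute the configuration outright.
* **`config_swap01`**, **`config_swap02`** — SLOT TRANSPORT: relabelling the slots by the transposition `(0 1)` (resp.
  `(0 2)`) turns a decomposition of cut pattern `(0; 01,12,34)` (resp. `(0; 02,12,34)`) into one of pattern `(0; 01,02,34)`
  (slices re-indexed, cofactors and pair factors pre-composed with the transposition, locality hypotheses transported);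
  hence the statement for `(0; 01,02,34)` implies the statements for the two other labellings, and NO «hub at slot 1/2»
  variants of Case 1 / Case 2 are needed.
HONEST FRAMING: bookkeeping toward the frontier rung `LaplaceOptimalFive` (stmt-24813); `hres` is NOT discharged here (the
Case-2 theorems are val-lit-p3 g14's, in flight); 24813/24814/18034 stay OPEN; nothing here bears on `VP ≠ VNP`. [folklore]
-/

set_option autoImplicit false

-- the mandated summit-side namespace repeats a component by design (single-problem summit)
set_option linter.dupNamespace false

namespace Summit.ValiantsHypothesis.ValiantsHypothesis.Theorems.RigidityForcesSymmetryRankRigidMinimalRepr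

namespace LaplaceResidual

open Finset

/-! ### §1 The Case-1 / Case-2 dichotomy -/

/-- If no covector with all coordinates non-zero is orthogonal to `α`, then `α` is a non-zero multiple of a basis
vector (a «letter indicator»). [folklore] -/
theorem indicator_of_not_fullSupport (α : Fin 5 → ℂ)
    (h : ¬ ∃ φ₀ : Fin 5 → ℂ, (∀ c, φ₀ c ≠ 0) ∧ ∑ c, φ₀ c * α c = 0) :
    ∃ a, α a ≠ 0 ∧ ∀ c, c ≠ a → α c = 0 := by
  by_contra hind
  exact h (exists_fullSupport_orthogonal' α hind)

/-- **Case 1 + Case 2 ⇒ the configuration.**  For any cut pattern `(p, q)`: if the configuration is refuted whenever some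
full-support covector is orthogonal to the slot-`0` slice vector (Case 1) and whenever that slice vector is a letter
indicator (Case 2), it is refuted. [folklore] -/
theorem config_of_cases (p q : Fin 3 → Fin 5)
    (case1 : ∀ (α : Fin 3 → Fin 5 → ℂ) (W : Fin 3 → (Fin 5 → Fin 5) → ℂ),
      (∀ k, ∀ v v' : Fin 5 → Fin 5, (∀ j, j ≠ (![0, 1, 2] : Fin 3 → Fin 5) k → v j = v' j) → W k v = W k v') →
      ∀ (u w : Fin 3 → (Fin 5 → Fin 5) → ℂ),
      (∀ t, ∀ v v' : Fin 5 → Fin 5, v (p t) = v' (p t) → v (q t) = v' (q t) → u t v = u t v') →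
      (∀ t, ∀ v v' : Fin 5 → Fin 5, (∀ j, j ≠ p t → j ≠ q t → v j = v' j) → w t v = w t v') →
      (∃ φ₀ : Fin 5 → ℂ, (∀ c, φ₀ c ≠ 0) ∧ ∑ c, φ₀ c * α 0 c = 0) →
      ¬ ∀ v : Fin 5 → Fin 5, (if Function.Injective v then (1 : ℂ) else 0) =
        (∑ k, α k (v ((![0, 1, 2] : Fin 3 → Fin 5) k)) * W k v) + ∑ t, u t v * w t v)
    (case2 : ∀ (α : Fin 3 → Fin 5 → ℂ) (W : Fin 3 → (Fin 5 → Fin 5) → ℂ),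
      (∀ k, ∀ v v' : Fin 5 → Fin 5, (∀ j, j ≠ (![0, 1, 2] : Fin 3 → Fin 5) k → v j = v' j) → W k v = W k v') →
      ∀ (u w : Fin 3 → (Fin 5 → Fin 5) → ℂ),
      (∀ t, ∀ v v' : Fin 5 → Fin 5, v (p t) = v' (p t) → v (q t) = v' (q t) → u t v = u t v') →
      (∀ t, ∀ v v' : Fin 5 → Fin 5, (∀ j, j ≠ p t → j ≠ q t → v j = v' j) → w t v = w t v') →
      (∃ a, α 0 a ≠ 0 ∧ ∀ c, c ≠ a → α 0 c = 0) →
      ¬ ∀ v : Fin 5 → Fin 5, (if Function.Injective v then (1 : ℂ) else 0) =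
        (∑ k, α k (v ((![0, 1, 2] : Fin 3 → Fin 5) k)) * W k v) + ∑ t, u t v * w t v)
    (α : Fin 3 → Fin 5 → ℂ) (W : Fin 3 → (Fin 5 → Fin 5) → ℂ)
    (hW : ∀ k, ∀ v v' : Fin 5 → Fin 5, (∀ j, j ≠ (![0, 1, 2] : Fin 3 → Fin 5) k → v j = v' j) → W k v = W k v')
    (u w : Fin 3 → (Fin 5 → Fin 5) → ℂ)
    (hu : ∀ t, ∀ v v' : Fin 5 → Fin 5, v (p t) = v' (p t) → v (q t) = v' (q t) → u t v = u t v')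
    (hw : ∀ t, ∀ v v' : Fin 5 → Fin 5, (∀ j, j ≠ p t → j ≠ q t → v j = v' j) → w t v = w t v') :
    ¬ ∀ v : Fin 5 → Fin 5, (if Function.Injective v then (1 : ℂ) else 0) =
      (∑ k, α k (v ((![0, 1, 2] : Fin 3 → Fin 5) k)) * W k v) + ∑ t, u t v * w t v := by
  by_cases hfull : ∃ φ₀ : Fin 5 → ℂ, (∀ c, φ₀ c ≠ 0) ∧ ∑ c, φ₀ c * α 0 c = 0
  · exact case1 α W hW u w hu hw hfull
  · exact case2 α W hW u w hu hw (indicator_of_not_fullSupport (α 0) hfull)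

/-! ### §2 Slot transport: `(0; 01,12,34)` and `(0; 02,12,34)` from `(0; 01,02,34)` -/

/-- Injectivity is invariant under pre-composition with a permutation of the slots. -/
theorem injective_comp_perm_iff (v : Fin 5 → Fin 5) (s : Equiv.Perm (Fin 5)) :
    Function.Injective (v ∘ s) ↔ Function.Injective v :=
  ⟨fun h => by simpa [Function.comp_assoc] using h.comp s.symm.injective,
   fun h => h.comp s.injective⟩

/-- **Transport by the slot transposition `(0 1)`**: the configuration statement for the cut pattern `(0; 01,02,34)`
implies the one for `(0; 01,12,34)`. [folklore] -/
theorem config_swap01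
    (hO0 : ∀ (α : Fin 3 → Fin 5 → ℂ) (W : Fin 3 → (Fin 5 → Fin 5) → ℂ),
      (∀ k, ∀ v v' : Fin 5 → Fin 5, (∀ j, j ≠ (![0, 1, 2] : Fin 3 → Fin 5) k → v j = v' j) → W k v = W k v') →
      ∀ (u w : Fin 3 → (Fin 5 → Fin 5) → ℂ),
      (∀ t, ∀ v v' : Fin 5 → Fin 5, v ((![0, 0, 3] : Fin 3 → Fin 5) t) = v' ((![0, 0, 3] : Fin 3 → Fin 5) t) →
        v ((![1, 2, 4] : Fin 3 → Fin 5) t) = v' ((![1, 2, 4] : Fin 3 → Fin 5) t) → u t v = u t v') →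
      (∀ t, ∀ v v' : Fin 5 → Fin 5, (∀ j, j ≠ (![0, 0, 3] : Fin 3 → Fin 5) t →
        j ≠ (![1, 2, 4] : Fin 3 → Fin 5) t → v j = v' j) → w t v = w t v') →
      ¬ ∀ v : Fin 5 → Fin 5, (if Function.Injective v then (1 : ℂ) else 0) =
        (∑ k, α k (v ((![0, 1, 2] : Fin 3 → Fin 5) k)) * W k v) + ∑ t, u t v * w t v)
    (α : Fin 3 → Fin 5 → ℂ) (W : Fin 3 → (Fin 5 → Fin 5) → ℂ)
    (hW : ∀ k, ∀ v v' : Fin 5 → Fin 5, (∀ j, j ≠ (![0, 1, 2] : Fin 3 → Fin 5) k → v j = v' j) → W k v = W k v')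
    (u w : Fin 3 → (Fin 5 → Fin 5) → ℂ)
    (hu : ∀ t, ∀ v v' : Fin 5 → Fin 5, v ((![0, 1, 3] : Fin 3 → Fin 5) t) = v' ((![0, 1, 3] : Fin 3 → Fin 5) t) →
      v ((![1, 2, 4] : Fin 3 → Fin 5) t) = v' ((![1, 2, 4] : Fin 3 → Fin 5) t) → u t v = u t v')
    (hw : ∀ t, ∀ v v' : Fin 5 → Fin 5, (∀ j, j ≠ (![0, 1, 3] : Fin 3 → Fin 5) t →
      j ≠ (![1, 2, 4] : Fin 3 → Fin 5) t → v j = v' j) → w t v = w t v') :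
    ¬ ∀ v : Fin 5 → Fin 5, (if Function.Injective v then (1 : ℂ) else 0) =
      (∑ k, α k (v ((![0, 1, 2] : Fin 3 → Fin 5) k)) * W k v) + ∑ t, u t v * w t v := by
  classical
  intro H
  let s : Equiv.Perm (Fin 5) := Equiv.swap 0 1
  have hs0 : s 0 = 1 := by simp [s]
  have hs1 : s 1 = 0 := by simp [s]
  have hs2 : s 2 = 2 := by decide
  have hs3 : s 3 = 3 := by decide
  have hs4 : s 4 = 4 := by decide
  -- transported data in the `(0; 01,02,34)` format
  let α' : Fin 3 → Fin 5 → ℂ := ![α 1, α 0, α 2]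
  let W' : Fin 3 → (Fin 5 → Fin 5) → ℂ := ![fun v => W 1 (v ∘ s), fun v => W 0 (v ∘ s), fun v => W 2 (v ∘ s)]
  let u' : Fin 3 → (Fin 5 → Fin 5) → ℂ := fun t v => u t (v ∘ s)
  let w' : Fin 3 → (Fin 5 → Fin 5) → ℂ := fun t v => w t (v ∘ s)
  refine hO0 α' W' ?_ u' w' ?_ ?_ ?_
  · -- cofactor locality
    intro k v v' h
    fin_cases k
    · exact hW 1 (v ∘ s) (v' ∘ s) (fun j hj => h (s j) (fun e => hj (by
        have := congrArg s e; simpa [s, Equiv.swap_apply_self] using this)))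
    · exact hW 0 (v ∘ s) (v' ∘ s) (fun j hj => h (s j) (fun e => hj (by
        have := congrArg s e; simpa [s, Equiv.swap_apply_self] using this)))
    · exact hW 2 (v ∘ s) (v' ∘ s) (fun j hj => h (s j) (fun e => hj (by
        have := congrArg s e; simpa [s, Equiv.swap_apply_self, Equiv.swap_apply_of_ne_of_ne] using this)))
  · -- pair factors read the transported cut slots
    intro t v v' h1 h2
    fin_cases t
    · exact hu 0 (v ∘ s) (v' ∘ s) (by simpa [hs0] using h2) (by simpa [hs1] using h1)
    · exact hu 1 (v ∘ s) (v' ∘ s) (by simpa [hs1] using h1) (by simpa [hs2] using h2)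
    · exact hu 2 (v ∘ s) (v' ∘ s) (by simpa [hs3] using h1) (by simpa [hs4] using h2)
  · -- pair cofactors blind to the transported cut slots
    intro t v v' h
    fin_cases t
    · exact hw 0 (v ∘ s) (v' ∘ s) (fun j hj1 hj2 => by
        show v (s j) = v' (s j)
        have hsj1 : s j ≠ 1 := fun e => hj1 (by have := congrArg s e; simpa [s] using this)
        have hsj0 : s j ≠ 0 := fun e => hj2 (by have := congrArg s e; simpa [s] using this)
        exact h (s j) (by simpa using hsj0) (by simpa using hsj1))
    · exact hw 1 (v ∘ s) (v' ∘ s) (fun j hj1 hj2 => by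
        show v (s j) = v' (s j)
        have hsj0 : s j ≠ 0 := fun e => hj1 (by have := congrArg s e; simpa [s] using this)
        have hsj2 : s j ≠ 2 := fun e => hj2 (by
          have := congrArg s e; simpa [s, Equiv.swap_apply_of_ne_of_ne] using this)
        exact h (s j) (by simpa using hsj0) (by simpa using hsj2))
    · exact hw 2 (v ∘ s) (v' ∘ s) (fun j hj1 hj2 => by
        show v (s j) = v' (s j)
        have hsj3 : s j ≠ 3 := fun e => hj1 (by
          have := congrArg s e; simpa [s, Equiv.swap_apply_of_ne_of_ne] using this)
        have hsj4 : s j ≠ 4 := fun e => hj2 (by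
          have := congrArg s e; simpa [s, Equiv.swap_apply_of_ne_of_ne] using this)
        exact h (s j) (by simpa using hsj3) (by simpa using hsj4))
  · -- the transported identity
    intro v
    have Hv := H (v ∘ s)
    simp only [injective_comp_perm_iff] at Hv
    rw [Hv]
    simp only [Fin.sum_univ_three, Function.comp_apply, Matrix.cons_val_zero, Matrix.cons_val_one,
      Matrix.cons_val_two, Matrix.tail_cons, Matrix.head_cons, hs0, hs1, hs2, α', W', u', w']
    ring

/-- **Transport by the slot transposition `(0 2)`**: the configuration statement for the cut pattern `(0; 01,02,34)`
implies the one for `(0; 02,12,34)` (pair terms re-indexed `t ↦ (1 0 2)`). [folklore] -/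
theorem config_swap02
    (hO0 : ∀ (α : Fin 3 → Fin 5 → ℂ) (W : Fin 3 → (Fin 5 → Fin 5) → ℂ),
      (∀ k, ∀ v v' : Fin 5 → Fin 5, (∀ j, j ≠ (![0, 1, 2] : Fin 3 → Fin 5) k → v j = v' j) → W k v = W k v') →
      ∀ (u w : Fin 3 → (Fin 5 → Fin 5) → ℂ),
      (∀ t, ∀ v v' : Fin 5 → Fin 5, v ((![0, 0, 3] : Fin 3 → Fin 5) t) = v' ((![0, 0, 3] : Fin 3 → Fin 5) t) →
        v ((![1, 2, 4] : Fin 3 → Fin 5) t) = v' ((![1, 2, 4] : Fin 3 → Fin 5) t) → u t v = u t v') →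
      (∀ t, ∀ v v' : Fin 5 → Fin 5, (∀ j, j ≠ (![0, 0, 3] : Fin 3 → Fin 5) t →
        j ≠ (![1, 2, 4] : Fin 3 → Fin 5) t → v j = v' j) → w t v = w t v') →
      ¬ ∀ v : Fin 5 → Fin 5, (if Function.Injective v then (1 : ℂ) else 0) =
        (∑ k, α k (v ((![0, 1, 2] : Fin 3 → Fin 5) k)) * W k v) + ∑ t, u t v * w t v)
    (α : Fin 3 → Fin 5 → ℂ) (W : Fin 3 → (Fin 5 → Fin 5) → ℂ)
    (hW : ∀ k, ∀ v v' : Fin 5 → Fin 5, (∀ j, j ≠ (![0, 1, 2] : Fin 3 → Fin 5) k → v j = v' j) → W k v = W k v')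
    (u w : Fin 3 → (Fin 5 → Fin 5) → ℂ)
    (hu : ∀ t, ∀ v v' : Fin 5 → Fin 5, v ((![0, 1, 3] : Fin 3 → Fin 5) t) = v' ((![0, 1, 3] : Fin 3 → Fin 5) t) →
      v ((![2, 2, 4] : Fin 3 → Fin 5) t) = v' ((![2, 2, 4] : Fin 3 → Fin 5) t) → u t v = u t v')
    (hw : ∀ t, ∀ v v' : Fin 5 → Fin 5, (∀ j, j ≠ (![0, 1, 3] : Fin 3 → Fin 5) t →
      j ≠ (![2, 2, 4] : Fin 3 → Fin 5) t → v j = v' j) → w t v = w t v') :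
    ¬ ∀ v : Fin 5 → Fin 5, (if Function.Injective v then (1 : ℂ) else 0) =
      (∑ k, α k (v ((![0, 1, 2] : Fin 3 → Fin 5) k)) * W k v) + ∑ t, u t v * w t v := by
  classical
  intro H
  let s : Equiv.Perm (Fin 5) := Equiv.swap 0 2
  have hs0 : s 0 = 2 := by simp [s]
  have hs1 : s 1 = 1 := by decide
  have hs2 : s 2 = 0 := by simp [s]
  have hs3 : s 3 = 3 := by decide
  have hs4 : s 4 = 4 := by decide
  -- transported data in the `(0; 01,02,34)` format: slices re-indexed by `(0 2)`, pairs by `(0 1)`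
  let α' : Fin 3 → Fin 5 → ℂ := ![α 2, α 1, α 0]
  let W' : Fin 3 → (Fin 5 → Fin 5) → ℂ := ![fun v => W 2 (v ∘ s), fun v => W 1 (v ∘ s), fun v => W 0 (v ∘ s)]
  let u' : Fin 3 → (Fin 5 → Fin 5) → ℂ := ![fun v => u 1 (v ∘ s), fun v => u 0 (v ∘ s), fun v => u 2 (v ∘ s)]
  let w' : Fin 3 → (Fin 5 → Fin 5) → ℂ := ![fun v => w 1 (v ∘ s), fun v => w 0 (v ∘ s), fun v => w 2 (v ∘ s)]
  refine hO0 α' W' ?_ u' w' ?_ ?_ ?_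
  · intro k v v' h
    fin_cases k
    · exact hW 2 (v ∘ s) (v' ∘ s) (fun j hj => h (s j) (fun e => hj (by
        have := congrArg s e; simpa [s, Equiv.swap_apply_self] using this)))
    · exact hW 1 (v ∘ s) (v' ∘ s) (fun j hj => h (s j) (fun e => hj (by
        have := congrArg s e; simpa [s, Equiv.swap_apply_self, Equiv.swap_apply_of_ne_of_ne] using this)))
    · exact hW 0 (v ∘ s) (v' ∘ s) (fun j hj => h (s j) (fun e => hj (by
        have := congrArg s e; simpa [s, Equiv.swap_apply_self] using this)))
  · intro t v v' h1 h2
    fin_cases t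
    · exact hu 1 (v ∘ s) (v' ∘ s) (by simpa [hs1] using h2) (by simpa [hs2] using h1)
    · exact hu 0 (v ∘ s) (v' ∘ s) (by simpa [hs0] using h2) (by simpa [hs2] using h1)
    · exact hu 2 (v ∘ s) (v' ∘ s) (by simpa [hs3] using h1) (by simpa [hs4] using h2)
  · intro t v v' h
    fin_cases t
    · exact hw 1 (v ∘ s) (v' ∘ s) (fun j hj1 hj2 => by
        show v (s j) = v' (s j)
        have hsj1 : s j ≠ 1 := fun e => hj1 (by
          have := congrArg s e; simpa [s, Equiv.swap_apply_of_ne_of_ne] using this)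
        have hsj0 : s j ≠ 0 := fun e => hj2 (by have := congrArg s e; simpa [s] using this)
        exact h (s j) (by simpa using hsj0) (by simpa using hsj1))
    · exact hw 0 (v ∘ s) (v' ∘ s) (fun j hj1 hj2 => by
        show v (s j) = v' (s j)
        have hsj0 : s j ≠ 0 := fun e => hj2 (by have := congrArg s e; simpa [s] using this)
        have hsj2 : s j ≠ 2 := fun e => hj1 (by have := congrArg s e; simpa [s] using this)
        exact h (s j) (by simpa using hsj0) (by simpa using hsj2))
    · exact hw 2 (v ∘ s) (v' ∘ s) (fun j hj1 hj2 => by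
        show v (s j) = v' (s j)
        have hsj3 : s j ≠ 3 := fun e => hj1 (by
          have := congrArg s e; simpa [s, Equiv.swap_apply_of_ne_of_ne] using this)
        have hsj4 : s j ≠ 4 := fun e => hj2 (by
          have := congrArg s e; simpa [s, Equiv.swap_apply_of_ne_of_ne] using this)
        exact h (s j) (by simpa using hsj3) (by simpa using hsj4))
  · intro v
    have Hv := H (v ∘ s)
    simp only [injective_comp_perm_iff] at Hv
    rw [Hv]
    simp only [Fin.sum_univ_three, Function.comp_apply, Matrix.cons_val_zero, Matrix.cons_val_one,
      Matrix.cons_val_two, Matrix.tail_cons, Matrix.head_cons, hs0, hs1, hs2, α', W', u', w']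
    ring

end LaplaceResidual

end Summit.ValiantsHypothesis.ValiantsHypothesis.Theorems.RigidityForcesSymmetryRankRigidMinimalRepr
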